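import Summits.Ventures.YMGap.RobustBall.StringTensionOnBallW
import Summits.Ventures.YMGap.RobustBall.AxialTowerAreaLaw
import HarnessLib

/-!
# Robust ball (Y2), area-law side — STRING TENSION of the axial-tower family and of the tier-2 VERTEX ball (infinite-volume readings)

HONEST FRAMING: venture file of the cell `pub-ymgap` (QuantumFields programme), track ROBUST-BALL, seat ds-4 (g6).  Strong-coupling LATTICE
statements; nothing about the continuum, a spectral mass gap, or Clay.  Two instances of rb-p2's infinite-volume form of the tier-2 area law
(`StringTensionOnBallW.suFundStringTension_ge_onBallW`: one pair `(C, c)`, `c > 0`, for every limit state of every family eventually in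
`ClusterDomain κ ε₀ ε₁ ∩ IsSlabLocal mv`): (i) the `SU(2)`, `β_W = 1/3` VERTEX ball `(log 6/5; 7/25, 7/50)` of `RobustAreaLawVertexW`
(rb-p2's own instance uses the lossy ball `(1/5, 1/10)`); (ii) the AXIAL-TOWER family of `AxialTowerWitness` / `AxialTowerAreaLaw` — an
INFINITE-RANGE perturbation (in no tier-1 ball): for `|τ| ≤ 1/6000` every infinite-volume limit state (they exist, `perturbedLimitPoints_nonempty`)
obeys the `ℤ⁴` area law `HasAreaLawWith μ χ₂ C c` and has string tension `≥ c` whenever its string tension exists (existence NOT asserted).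
-/

noncomputable section

open MeasureTheory Filter Topology
open Literature.MathematicalPhysics.QuantumLattice
open Literature.MathematicalPhysics.QuantumFieldTheory hiding ZdEdge Site
open Literature.Barriers.QuantumFields (suFundStringTension suFundStringTension_def)

namespace Summit.Ventures.YMGap.RobustBall

/-- **`SU(2)`, `d = 4`, `β_W = 1/3`, TIER-2 VERTEX ball `(κ, ε₀, ε₁) = (log 6/5, 7/25, 7/50)` (no range cut-off; window `mv ≥ 1`): string tension on
the ball.**  One `c > 0` such that every limit state of every eventually-member family satisfies `HasAreaLawWith μ χ₂ C c` and, whenever its string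
tension exists, `c ≤ suFundStringTension 2 μ`.  Input: `su2_areaLawOnBallW_vertex_oneThird_w65` through rb-p2's `suFundStringTension_ge_onBallW`.
[folklore] -/
theorem su2_stringTension_onBallW_vertex_oneThird_w65 {mv : ℕ} (hmv : 1 ≤ mv) :
    ∃ C c : ℝ, 0 < c ∧ ∀ 𝓦 : PerturbationFamily 4 2,
      (∀ᶠ L : ℕ in atTop, 𝓦 L ∈ ClusterDomain (Real.log (6 / 5)) (7 / 25) (7 / 50) ∧ IsSlabLocal mv (𝓦 L)) →
        ∀ μ ∈ perturbedLimitPoints (1 / 6) 𝓦,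
          HasAreaLawWith μ (fun g => normalisedCharacter 2 (fundamentalRep (Fin 2) g)) C c ∧
          ((∃ σ : ℝ, HasStringTension μ (fun g => normalisedCharacter 2 (fundamentalRep (Fin 2) g)) σ) →
            c ≤ suFundStringTension 2 μ) :=
  suFundStringTension_ge_onBallW (su2_areaLawOnBallW_vertex_oneThird_w65 hmv)

/-- **THE AXIAL-TOWER FAMILY: an INFINITE-RANGE perturbation all of whose infinite-volume limit states obey ONE area law.**  There are `C`, `c > 0`
such that for every `|τ| ≤ 1/6000` and every infinite-volume limit state `μ` (they exist: `perturbedLimitPoints_nonempty`) of the `SU(2)`,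
`β_W = 1/3` measures perturbed by the axial-tower action `towerWitness 4 (L+1) 2 τ (1/2)` (every plaquette coupled to all its axial translates,
coefficients `τ/2^{s+1}`; in no tier-1 ball, `su2_towerWitness_not_tierOne`): `HasAreaLawWith μ χ₂ C c`, and `c ≤ suFundStringTension 2 μ` whenever
the string tension exists. [folklore] -/
theorem su2_towerWitness_stringTension :
    ∃ C c : ℝ, 0 < c ∧ ∀ τ : ℝ, |τ| ≤ 1 / 6000 →
      ∀ μ ∈ perturbedLimitPoints (1 / 6) (fun L => towerWitness 4 (L + 1) 2 τ (1 / 2)),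
        HasAreaLawWith μ (fun g => normalisedCharacter 2 (fundamentalRep (Fin 2) g)) C c ∧
        ((∃ σ : ℝ, HasStringTension μ (fun g => normalisedCharacter 2 (fundamentalRep (Fin 2) g)) σ) →
          c ≤ suFundStringTension 2 μ) := by
  obtain ⟨C, c, hc, h⟩ := su2_stringTension_onBallW_vertex_oneThird_w65 (mv := 2) (by norm_num)
  exact ⟨C, c, hc, fun τ hτ μ hμ => h (fun L => towerWitness 4 (L + 1) 2 τ (1 / 2))
    (Eventually.of_forall fun L => ⟨su2_towerWitness_mem_clusterDomain hτ, isSlabLocal_towerWitness 2 τ (1 / 2)⟩) μ hμ⟩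

/-- **Limit states of the axial-tower family exist** (compactness, rb-p2's `perturbedLimitPoints_nonempty`), so the previous theorem is not
vacuous. [folklore] -/
theorem su2_towerWitness_limitPoints_nonempty (τ : ℝ) :
    (perturbedLimitPoints (d := 4) (N := 2) (1 / 6) (fun L => towerWitness 4 (L + 1) 2 τ (1 / 2))).Nonempty :=
  perturbedLimitPoints_nonempty _ _

end Summit.Ventures.YMGap.RobustBall

end
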